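import Mathlib
import Summits.ValiantsHypothesis.ValiantsHypothesis.Theorems.NewtonUnitEquationsNewtonTauWeakMedianBound
import Summits.ValiantsHypothesis.ValiantsHypothesis.Theorems.NewtonUnitEquationsNewtonTauWeakFourCoreSplitting

/-!
# The three-bin law with exponent `b = 3` (crux `NewtonTauWeak`, line `binomial-normal-form`, kill criterion)

`coreDesign_threeBinLaw`: EVERY `c`-core sign design `h : Fin c → Finset (Fin x) → ℕ²` has at most
`(2^{x+c} · (c · 2^x) + 2)^3` strictly positively exposed configuration points — the allowance that
`stub_coreDesignKillSwitch` derives from T2 with exponent `b = 3`, here proved UNCONDITIONALLY.  Hence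
`not_hbigDesigns`: the hypothesis of the kill criterion `not_T2_of_designs` (designs beating the allowance for every
`b`) is unsatisfiable — the `c`-core sign-design family cannot refute the common-exponent binomial form T2 of
`stub_binomialNewtonTauCommon` (card `Cruxes/NewtonTauWeak/Lines/binomial-normal-form-c7.md` §2, §9.3).
Proof: strictly positively exposed points are chart points (`FourCoreSplittingAux.chart_of_exposed`), bounded by
`coreChart_medianBound` with `k = Nat.size x` (`(2c)^{size x} · 9^x`), and `(2c)^{size x} · 9^x ≤ 4^c · 36^x ≤
(2^{x+c} · (c · 2^x) + 2)^3` (`MedianArith.final_bound`).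
-/

-- Sub = Summit single-conjunct layout: the duplicated namespace component is mandated by the tree.
set_option linter.dupNamespace false

open scoped BigOperators

namespace Summit.ValiantsHypothesis.ValiantsHypothesis.Theorems.NewtonUnitEquationsNewtonTauWeak

namespace MedianArith


/-- `K² + 2 ≤ 2^{K+1}` for `K ≥ 1`. [folklore] -/
theorem sq_add_two_le (K : ℕ) (hK : 1 ≤ K) : K ^ 2 + 2 ≤ 2 ^ (K + 1) := by
  induction K, hK using Nat.le_induction with
  | base => norm_num
  | succ n hn ih =>
    have h2 : 2 * n + 1 ≤ 2 ^ (n + 1) := by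
      have := Nat.lt_two_pow_self (n := n)
      rw [pow_succ]
      omega
    calc (n + 1) ^ 2 + 2 = (n ^ 2 + 2) + (2 * n + 1) := by ring
      _ ≤ 2 ^ (n + 1) + 2 ^ (n + 1) := Nat.add_le_add ih h2
      _ = 2 ^ (n + 1 + 1) := by rw [pow_succ 2 (n + 1)]; ring

/-- `s² ≤ 2^s + 2` for every `s`. [folklore] -/
theorem sq_le_two_pow_add_two (s : ℕ) : s ^ 2 ≤ 2 ^ s + 2 := by
  rcases Nat.lt_or_ge s 4 with hs | hs
  · interval_cases s <;> norm_num
  · induction s, hs using Nat.le_induction with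
    | base => norm_num
    | succ n hn ih =>
      have h2 : 2 * n + 1 ≤ 2 ^ n := by
        clear ih
        induction n, hn using Nat.le_induction with
        | base => norm_num
        | succ m hm ihm => rw [pow_succ]; omega
      calc (n + 1) ^ 2 = n ^ 2 + (2 * n + 1) := by ring
        _ ≤ (2 ^ n + 2) + 2 ^ n := Nat.add_le_add ih h2
        _ = 2 ^ (n + 1) + 2 := by rw [pow_succ]; ring

/-- `K·s ≤ 2^K + 2^{s-1}` for `K, s ≥ 1` (from `2Ks ≤ K² + s²` and the two bounds above). [folklore] -/
theorem mul_le_two_pow_add (K s : ℕ) (hK : 1 ≤ K) (hs : 1 ≤ s) : K * s ≤ 2 ^ K + 2 ^ (s - 1) := by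
  have h1 : 2 * (K * s) ≤ K ^ 2 + s ^ 2 := by nlinarith [sq_nonneg ((K : ℤ) - s), sq_abs ((K : ℤ) - s)]
  obtain ⟨s', rfl⟩ : ∃ s', s = s' + 1 := ⟨s - 1, by omega⟩
  have hK2 := sq_add_two_le K hK
  have hs2 := sq_le_two_pow_add_two (s' + 1)
  rw [show (2 : ℕ) ^ (K + 1) = 2 ^ K * 2 from pow_succ 2 K] at hK2
  rw [show (2 : ℕ) ^ (s' + 1) = 2 ^ s' * 2 from pow_succ 2 s'] at hs2
  rw [Nat.add_sub_cancel]
  omega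

/-- `c^{size x} ≤ 4^c · 2^x`: the polynomial factor of the uniform bound is absorbed by the allowance. [folklore] -/
theorem pow_size_le (c x : ℕ) : c ^ Nat.size x ≤ 4 ^ c * 2 ^ x := by
  rcases Nat.eq_zero_or_pos c with rfl | hc
  · calc 0 ^ Nat.size x ≤ 1 := by
          rcases Nat.eq_zero_or_pos (Nat.size x) with h0 | h0
          · rw [h0, pow_zero]
          · rw [zero_pow h0.ne']; exact Nat.zero_le _
      _ ≤ 4 ^ 0 * 2 ^ x := by rw [pow_zero, one_mul]; exact Nat.one_le_two_pow
  rcases Nat.eq_zero_or_pos x with rfl | hx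
  · rw [Nat.size_zero, pow_zero, pow_zero, mul_one]
    exact Nat.one_le_pow _ _ (by norm_num)
  have hK : 1 ≤ Nat.size c := Nat.size_pos.mpr hc
  have hs : 1 ≤ Nat.size x := Nat.size_pos.mpr hx
  have hcK : c < 2 ^ Nat.size c := Nat.lt_size_self c
  have hKc : 2 ^ (Nat.size c - 1) ≤ c := Nat.lt_size.mp (by omega)
  have hsx : 2 ^ (Nat.size x - 1) ≤ x := Nat.lt_size.mp (by omega)
  have h2K : 2 ^ Nat.size c ≤ 2 * c := by
    calc 2 ^ Nat.size c = 2 * 2 ^ (Nat.size c - 1) := by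
          rw [← pow_succ']; congr 1; omega
      _ ≤ 2 * c := Nat.mul_le_mul_left 2 hKc
  calc c ^ Nat.size x ≤ (2 ^ Nat.size c) ^ Nat.size x := Nat.pow_le_pow_left hcK.le _
    _ = 2 ^ (Nat.size c * Nat.size x) := by rw [← pow_mul]
    _ ≤ 2 ^ (2 ^ Nat.size c + 2 ^ (Nat.size x - 1)) :=
        Nat.pow_le_pow_right (by norm_num) (mul_le_two_pow_add _ _ hK hs)
    _ ≤ 2 ^ (2 * c + x) := Nat.pow_le_pow_right (by norm_num) (Nat.add_le_add h2K hsx)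
    _ = 4 ^ c * 2 ^ x := by rw [pow_add, pow_mul]; norm_num

/-- The uniform bound sits inside the `b = 3` allowance: `(2c)^{size x} · 9^x ≤ (2^{x+c}·(c·2^x) + 2)^3` for `c ≥ 1`.
[folklore] -/
theorem final_bound (c x : ℕ) (hc : 1 ≤ c) :
    (2 * c) ^ Nat.size x * 9 ^ x ≤ (2 ^ (x + c) * (c * 2 ^ x) + 2) ^ 3 := by
  have hsx : Nat.size x ≤ x := Nat.size_le.mpr Nat.lt_two_pow_self
  have h36 : (36 : ℕ) ^ x = 2 ^ x * 2 ^ x * 9 ^ x := by rw [← mul_pow, ← mul_pow]; norm_num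
  have h864 : (8 : ℕ) ^ c * 64 ^ x = (2 ^ (x + c) * 2 ^ x) ^ 3 := by
    rw [show (8 : ℕ) = 2 ^ 3 by norm_num, show (64 : ℕ) = 2 ^ 6 by norm_num, ← pow_mul, ← pow_mul, ← pow_add,
      mul_pow, ← pow_mul, ← pow_mul, ← pow_add]
    congr 1
    ring
  calc (2 * c) ^ Nat.size x * 9 ^ x = 2 ^ Nat.size x * c ^ Nat.size x * 9 ^ x := by rw [mul_pow]
    _ ≤ 2 ^ x * (4 ^ c * 2 ^ x) * 9 ^ x :=
        Nat.mul_le_mul_right _ (Nat.mul_le_mul (Nat.pow_le_pow_right (by norm_num) hsx) (pow_size_le c x))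
    _ = 4 ^ c * 36 ^ x := by rw [h36]; ring
    _ ≤ 8 ^ c * 64 ^ x := Nat.mul_le_mul (Nat.pow_le_pow_left (by norm_num) c) (Nat.pow_le_pow_left (by norm_num) x)
    _ = (2 ^ (x + c) * 2 ^ x) ^ 3 := h864
    _ ≤ (2 ^ (x + c) * (c * 2 ^ x)) ^ 3 :=
        Nat.pow_le_pow_left (Nat.mul_le_mul_left _ (Nat.le_mul_of_pos_left _ hc)) 3
    _ ≤ (2 ^ (x + c) * (c * 2 ^ x) + 2) ^ 3 := Nat.pow_le_pow_left (Nat.le_add_right _ _) 3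

end MedianArith

/-- **THE THREE-BIN LAW WITH EXPONENT `b = 3` (PROVED).**  For every `c`-core sign design `h : Fin c → Finset (Fin x) → ℕ²`
the design points `Σ_d h d (f⁻¹ d)`, `f : Fin x → Fin c`, that are strict minimisers among all design points of some
`w₀ x₀ + w₁ x₁` with `w₀, w₁ > 0` number at most `(2^{x+c} · (c · 2^x) + 2)^3` — the allowance of
`stub_coreDesignKillSwitch` at `b = 3`, unconditionally.  (Sharper: at most `(2c)^{⌊log₂ x⌋+1} · 9^x`, per-element base
`9` uniformly in `c`, `coreChart_medianBound`.) [folklore] -/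
theorem coreDesign_threeBinLaw (c x : ℕ) (h : Fin c → Finset (Fin x) → (Fin 2 →₀ ℕ)) :
    {q : Fin 2 →₀ ℕ | (∃ f : Fin x → Fin c, ∑ d, h d (Finset.univ.filter fun u => f u = d) = q ∧
          ∃ w : Fin 2 → ℝ, 0 < w 0 ∧ 0 < w 1 ∧ ∀ f' : Fin x → Fin c,
            ∑ d, h d (Finset.univ.filter fun u => f' u = d) ≠ q →
            w 0 * ((q 0 : ℕ) : ℝ) + w 1 * ((q 1 : ℕ) : ℝ) <
              w 0 * (((∑ d, h d (Finset.univ.filter fun u => f' u = d)) 0 : ℕ) : ℝ) +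
                w 1 * (((∑ d, h d (Finset.univ.filter fun u => f' u = d)) 1 : ℕ) : ℝ))}.ncard ≤
      (2 ^ (x + c) * (c * 2 ^ x) + 2) ^ 3 := by
  -- the exposed set lies in the (finite) cloud of all design points
  have hsub : {q : Fin 2 →₀ ℕ | (∃ f : Fin x → Fin c, ∑ d, h d (Finset.univ.filter fun u => f u = d) = q ∧
          ∃ w : Fin 2 → ℝ, 0 < w 0 ∧ 0 < w 1 ∧ ∀ f' : Fin x → Fin c,
            ∑ d, h d (Finset.univ.filter fun u => f' u = d) ≠ q →
            w 0 * ((q 0 : ℕ) : ℝ) + w 1 * ((q 1 : ℕ) : ℝ) <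
              w 0 * (((∑ d, h d (Finset.univ.filter fun u => f' u = d)) 0 : ℕ) : ℝ) +
                w 1 * (((∑ d, h d (Finset.univ.filter fun u => f' u = d)) 1 : ℕ) : ℝ))} ⊆
      {p : Fin 2 →₀ ℕ | p ∈ (Finset.univ.image fun f : Fin x → Fin c =>
            ∑ d, h d (Finset.univ ∩ Finset.univ.filter fun u => f u = d)) ∧
          ∃ t : ℝ, ∀ q ∈ (Finset.univ.image fun f : Fin x → Fin c =>
            ∑ d, h d (Finset.univ ∩ Finset.univ.filter fun u => f u = d)), q ≠ p →
            t * ((q 0 : ℕ) : ℝ) + (-1) * ((q 1 : ℕ) : ℝ) < t * ((p 0 : ℕ) : ℝ) + (-1) * ((p 1 : ℕ) : ℝ)} := by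
    rintro q ⟨f, rfl, w, -, hw1, hmin⟩
    simp only [Finset.univ_inter, Set.mem_setOf_eq]
    refine ⟨Finset.mem_image_of_mem _ (Finset.mem_univ f), -(w 0 / w 1), fun q' hq' hne => ?_⟩
    obtain ⟨f', -, rfl⟩ := Finset.mem_image.mp hq'
    exact FourCoreSplittingAux.chart_of_exposed hw1 (hmin f' hne)
  rcases Nat.eq_zero_or_pos c with rfl | hc
  · -- no cores: at most `0^x ≤ 1` design points
    refine (Set.ncard_le_ncard hsub ((Finset.finite_toSet _).subset fun p hp => hp.1)).trans ?_
    calc _ ≤ ((Finset.univ.image fun f : Fin x → Fin 0 =>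
            ∑ d, h d (Finset.univ ∩ Finset.univ.filter fun u => f u = d)) : Set (Fin 2 →₀ ℕ)).ncard :=
          Set.ncard_le_ncard (fun p hp => hp.1) (Finset.finite_toSet _)
      _ ≤ (Finset.univ : Finset (Fin x → Fin 0)).card := by
          rw [Set.ncard_coe_finset]; exact Finset.card_image_le
      _ = 0 ^ x := by rw [Finset.card_univ, Fintype.card_fun, Fintype.card_fin, Fintype.card_fin]
      _ ≤ 1 := by rw [← one_pow x]; exact Nat.pow_le_pow_left (Nat.zero_le 1) x
      _ ≤ (2 ^ (x + 0) * (0 * 2 ^ x) + 2) ^ 3 := by norm_num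
  · have hchart := coreChart_medianBound x c (Nat.size x) hc Finset.univ
      (by rw [Finset.card_univ, Fintype.card_fin]; exact Nat.lt_size_self x) h
    rw [Finset.card_univ, Fintype.card_fin] at hchart
    exact (Set.ncard_le_ncard hsub ((Finset.finite_toSet _).subset fun p hp => hp.1)).trans
      (hchart.trans (MedianArith.final_bound c x hc))

/-- **The kill criterion is void: no design family beats the allowance for every `b`.**  The hypothesis `hbig` of
`not_T2_of_designs` (`Theorems/…CoreKillCriterion.lean`) fails at `b = 3` by `coreDesign_threeBinLaw`: the `c`-core
sign-design family of the card (§2, §9) cannot refute T2. [folklore] -/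
theorem not_hbigDesigns :
    ¬ ∀ b : ℕ, ∃ (c x : ℕ) (h : Fin c → Finset (Fin x) → (Fin 2 →₀ ℕ)),
      (2 ^ (x + c) * (c * 2 ^ x) + 2) ^ b <
        {q : Fin 2 →₀ ℕ | (∃ f : Fin x → Fin c, ∑ d, h d (Finset.univ.filter fun u => f u = d) = q ∧
          ∃ w : Fin 2 → ℝ, 0 < w 0 ∧ 0 < w 1 ∧ ∀ f' : Fin x → Fin c,
            ∑ d, h d (Finset.univ.filter fun u => f' u = d) ≠ q →
            w 0 * ((q 0 : ℕ) : ℝ) + w 1 * ((q 1 : ℕ) : ℝ) <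
              w 0 * (((∑ d, h d (Finset.univ.filter fun u => f' u = d)) 0 : ℕ) : ℝ) +
                w 1 * (((∑ d, h d (Finset.univ.filter fun u => f' u = d)) 1 : ℕ) : ℝ))}.ncard := by
  intro hbig
  obtain ⟨c, x, h, hlt⟩ := hbig 3
  exact absurd (coreDesign_threeBinLaw c x h) (not_le.mpr hlt)

/-- **The three-bin law in the `∃ b` form** (the positive side of the dichotomy `ThreeBinLaw ∨ HBigDesigns`):
some exponent `b` bounds the strictly positively exposed points of every `c`-core design by `(2^{x+c}·(c·2^x)+2)^b`.
[folklore] -/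
theorem exists_threeBinLaw :
    ∃ b : ℕ, ∀ (c x : ℕ) (h : Fin c → Finset (Fin x) → (Fin 2 →₀ ℕ)),
      {q : Fin 2 →₀ ℕ | (∃ f : Fin x → Fin c, ∑ d, h d (Finset.univ.filter fun u => f u = d) = q ∧
          ∃ w : Fin 2 → ℝ, 0 < w 0 ∧ 0 < w 1 ∧ ∀ f' : Fin x → Fin c,
            ∑ d, h d (Finset.univ.filter fun u => f' u = d) ≠ q →
            w 0 * ((q 0 : ℕ) : ℝ) + w 1 * ((q 1 : ℕ) : ℝ) <
              w 0 * (((∑ d, h d (Finset.univ.filter fun u => f' u = d)) 0 : ℕ) : ℝ) +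
                w 1 * (((∑ d, h d (Finset.univ.filter fun u => f' u = d)) 1 : ℕ) : ℝ))}.ncard ≤
        (2 ^ (x + c) * (c * 2 ^ x) + 2) ^ b :=
  ⟨3, coreDesign_threeBinLaw⟩

end Summit.ValiantsHypothesis.ValiantsHypothesis.Theorems.NewtonUnitEquationsNewtonTauWeak
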